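import Summits.AtomisticToContinuum.BoseEinsteinCondensation.Theorems.BECRewardDescentRewardChordBoundSecantWalkReal

/-!
# Crux `RewardChordBound` (stmt-AtomisticToContinuum-12876), line `dyadic-secant` — stub `stub_secantWalk`,
# part 2/2: the registered stub (the discrete reward walk for an infimum of affine functions in `ℝ≥0∞`;
# the real-analysis core is part 1/2, `BECRewardDescentRewardChordBoundSecantWalkReal.lean`)

Registered stub `Summit.AtomisticToContinuum.BoseEinsteinCondensation.Cruxes.RewardChordBound.DyadicSecant.stub_secantWalk`
of the crux skeleton `Cruxes/RewardChordBound/Lines/birth.lean` (lead c2 reshape: the strategist's alternative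
composition `RewardChordBound ⇐ stub_shellModulus ∧ stub_secantWalk` carried beside the `Birth` composition).

Statement (abstract, over a family `i ↦ Eᵢ + t·Dᵢ` in `ℝ≥0∞` with `Dᵢ ≤ N`, `⨅ Eᵢ < ∞`, reward curve
`R(t) = ⨅ᵢ (Eᵢ + t·Dᵢ)` and a predicate `P` implied by `Dᵢ < ηN`): for `η, K, τ > 0`, `σ ∈ (0, 1]` there is
`θ ∈ (0, σ/4]` such that IF (rung) `R(s₀) ≤ ⨅E + s₀(η/4)N` at `s₀ = θρa` and (shells) for every `u` with
`4u ≤ σρa`, whenever the near-minimisers of `Eᵢ + w·Dᵢ` satisfy `P` for each `w ∈ (2u, 4u]` one has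
`3R(2u) ≤ 2R(u) + R(4u) + KNu√(u/(ρa))`, THEN `R(s) + (s/s₀)⨅E ≤ ⨅E + (s/s₀)R(s₀) + sτN` on `(0, s₀]`.

## Proof (no derivatives, no continuity — secants of the concave, non-decreasing real curve `f = R.toReal`)

* Griffiths' lemma in secant form (`WalkGlue.le_slope_add_of_near_min`): if some secant slope `σ(w', w) < ηN`
  (`0 ≤ w' < w`), then for a suitable `δ > 0` every `δ`-near-minimiser `i` at reward `w` has `Dᵢ < ηN`, hence `P i`.
  Call such `w` GOOD. Good rewards are upward closed (secant slopes of a concave function decrease), and every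
  `w ≥ s₀` is good by the rung (`σ(0, w) ≤ σ(0, s₀) ≤ ηN/4`).
* One shell in secant form: `σ(u, 2u) ≤ σ(2u, 4u) + A√u` with `A = KN/(2√(ρa))`; the POTENTIAL
  `g(u) = σ(u,2u) + (5/2)A√u` is then non-decreasing under doubling (`7/5 ≤ √2`), so along any dyadic chain of
  available shells `σ(u, 2u) ≤ g(top) ≤ σ(0, s₀) + (5/2)A√s₀` — no geometric series is summed.
* Frontier: `s* = inf {good}`; if `s* > 0`, all shells with `2u ≥ s*` are available (their upper half-shells are
  good), the ascending chain from `u = s*/2` gives `σ(s*/2, s*) ≤ ηN/4 + (5/2)A√s₀ ≤ ηN/2`, and monotonicity of `f`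
  alone gives `σ(s*/2, 7s*/8) ≤ (4/3)σ(s*/2, s*) < ηN`, so `7s*/8` is good — contradiction. Hence every `w > 0`
  is good and every shell `4u ≤ σρa` is available.
* Descending chain anchored at `s₀`: `σ(s₀2^{-m-1}, s₀2^{-m}) ≤ B := σ(0,s₀) + (5/2)A√s₀`; telescoping with
  `f(t) − f(0) ≤ tN` gives `σ(0, s₀2^{-m}) ≤ B`, and `σ(0, s) ≤ σ(0, s₀2^{-m}) ≤ B` for `s₀2^{-m} ≤ s`.
* Constants: `(5/2)A√s₀ = (5/4)K√θ·N`; `θ := min(σ/4, (min(τ/2, η/5)/K)²)`.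

References: concavity of a ground-state energy in a coupling constant and the near-minimiser slope bound
[Griffiths1966, §III]; [Kato1966, VII §3]; route text of BECRewardDescent (items WalkGlue / RewardChordBound);
strategist line card `Cruxes/RewardChordBound/Lines/dyadic-secant.md`.
-/

noncomputable section

open Set Filter Topology
open scoped ENNReal

namespace Summit.AtomisticToContinuum.BoseEinsteinCondensation.Cruxes.RewardChordBound.DyadicSecant

open Summit.AtomisticToContinuum.BoseEinsteinCondensation.Theorems.WalkGlue
open Summit.AtomisticToContinuum.BoseEinsteinCondensation.Cruxes.RewardChordBound.Birth.ChordFromModulus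

open SecantWalk in
/-- **Registered stub `stub_secantWalk` of crux `RewardChordBound` (line `dyadic-secant`) — the discrete
reward walk.** For `η, K, τ > 0` and `σ ∈ (0, 1]` there is `θ ∈ (0, σ/4]` (namely
`θ = min(σ/4, (min(τ/2, η/5)/K)²)`) such that for every family `i ↦ Eᵢ + t·Dᵢ` in `ℝ≥0∞` with `Dᵢ ≤ N`,
`⨅ Eᵢ < ∞`, reward curve `R(t) = ⨅ᵢ (Eᵢ + t·Dᵢ)` and a predicate `P` implied by `Dᵢ < ηN`: IF (rung)
`R(s₀) ≤ ⨅E + s₀(η/4)N` at `s₀ = θρa` and (shells) for every `u` with `4u ≤ σρa`, whenever for each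
`w ∈ (2u, 4u]` the near-minimisers of `Eᵢ + w·Dᵢ` satisfy `P` one has `3R(2u) ≤ 2R(u) + R(4u) + KNu√(u/(ρa))`,
THEN `R(s) + (s/s₀)⨅E ≤ ⨅E + (s/s₀)R(s₀) + sτN` on `(0, s₀]`. Proof: `N = 0` — `R` is constant; `N ≥ 1` —
`SecantWalk.secant_walk_real` for the concave non-decreasing real curve `t ↦ (R t).toReal` with
`A = KN/(2√(ρa))`, `M = ηN`, `S = σρa`, the Griffiths step `WalkGlue.le_slope_add_of_near_min` discharging the
condensation hypothesis of a shell from a secant slope `< ηN`, and `WalkGlue.ennreal_chord_of_real_chord`.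
[cite: Griffiths1966, §III] [cite: Kato1966, VII §3] -/
theorem stub_secantWalk :
    ∀ (η K τ σ : ℝ), 0 < η → 0 < K → 0 < τ → 0 < σ → σ ≤ 1 → ∃ θ : ℝ, 0 < θ ∧ θ ≤ σ / 4 ∧
      ∀ (ι : Type) (E D : ι → ENNReal) (P : ι → Prop) (Rₑ : ℝ → ENNReal) (N : ℕ) (ρ a : ℝ),
        (∀ t : ℝ, Rₑ t = ⨅ i, (E i + ENNReal.ofReal t * D i)) → (∀ i, D i ≤ (N : ENNReal)) →
        (⨅ i, E i) ≠ ⊤ → (∀ i, D i < ENNReal.ofReal (η * N) → P i) →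
        (0 < θ * ρ * a → Rₑ (θ * ρ * a) ≤ (⨅ i, E i) + ENNReal.ofReal (θ * ρ * a * (η / 4) * N)) →
        (∀ u : ℝ, 0 < u → 4 * u ≤ σ * ρ * a →
          (∀ w : ℝ, 2 * u < w → w ≤ 4 * u → ∃ δ : ENNReal, 0 < δ ∧
            ∀ i, E i + ENNReal.ofReal w * D i ≤ Rₑ w + δ → P i) →
          3 * Rₑ (2 * u) ≤ 2 * Rₑ u + Rₑ (4 * u) + ENNReal.ofReal (K * N * u * Real.sqrt (u / (ρ * a)))) →
        ∀ s : ℝ, 0 < s → s ≤ θ * ρ * a →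
          Rₑ s + ENNReal.ofReal (s / (θ * ρ * a)) * (⨅ i, E i) ≤
            (⨅ i, E i) + ENNReal.ofReal (s / (θ * ρ * a)) * Rₑ (θ * ρ * a) + ENNReal.ofReal (s * τ * N) := by
  intro η K τ σ hη hK hτ hσ _hσ1
  -- the walk scale `θ`
  obtain ⟨m, hm_def⟩ : ∃ m : ℝ, m = min (τ / 2) (η / 5) := ⟨_, rfl⟩
  have hm0 : 0 < m := by rw [hm_def]; exact lt_min (half_pos hτ) (by positivity)
  have hmτ : m ≤ τ / 2 := hm_def ▸ min_le_left _ _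
  have hmη : m ≤ η / 5 := hm_def ▸ min_le_right _ _
  obtain ⟨θ, hθ_def⟩ : ∃ θ : ℝ, θ = min (σ / 4) ((m / K) ^ 2) := ⟨_, rfl⟩
  have hθ : 0 < θ := by rw [hθ_def]; exact lt_min (by positivity) (by positivity)
  have hθσ : θ ≤ σ / 4 := hθ_def ▸ min_le_left _ _
  have hKθ : K * Real.sqrt θ ≤ m := by
    have h1 : Real.sqrt θ ≤ Real.sqrt ((m / K) ^ 2) :=
      Real.sqrt_le_sqrt (hθ_def ▸ min_le_right _ _)
    rw [Real.sqrt_sq (by positivity)] at h1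
    calc K * Real.sqrt θ ≤ K * (m / K) := mul_le_mul_of_nonneg_left h1 hK.le
      _ = m := by field_simp
  refine ⟨θ, hθ, hθσ, ?_⟩
  intro ι E D P Rₑ N ρ a hRdef hD hE hP hrung hshell s hs hsle
  have hNtop : (N : ℝ≥0∞) ≠ ⊤ := ENNReal.natCast_ne_top N
  have hfin : ∀ t, Rₑ t ≠ ⊤ := fun t => (hRdef t).symm ▸ iInf_affine_ne_top E D hD hNtop hE t
  have hR0 : Rₑ 0 = ⨅ i, E i := (hRdef 0).trans (iInf_affine_zero E D)
  have hs₀ : 0 < θ * ρ * a := hs.trans_le hsle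
  have hρa : 0 < ρ * a := by
    rw [mul_assoc] at hs₀
    exact pos_of_mul_pos_right hs₀ hθ.le
  -- no particles: the curve is constant
  rcases Nat.eq_zero_or_pos N with hN0 | hNpos
  · subst hN0
    have hD0 : ∀ i, D i = 0 := fun i => le_antisymm ((hD i).trans (by simp)) bot_le
    have hconst : ∀ t, Rₑ t = ⨅ i, E i := fun t => by simp [hRdef, hD0]
    rw [hconst, hconst]
    exact le_self_add
  have hNr : (0 : ℝ) < N := Nat.cast_pos.2 hNpos
  -- the real curve: concave, non-decreasing, `N`-Lipschitz from `0`
  obtain ⟨Rr, hRr⟩ : ∃ Rr : ℝ → ℝ, ∀ t, (Rₑ t).toReal = Rr t := ⟨_, fun _ => rfl⟩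
  have hconc : ConcaveOn ℝ (Ici 0) Rr := by
    have h := concaveOn_toReal_iInf_affine E D hD hNtop hE
    simp only [← hRdef, hRr] at h
    exact h
  have hmonoR : MonotoneOn Rr (Ici 0) := by
    intro x _ y _ hxy
    rw [← hRr, ← hRr, hRdef, hRdef]
    exact ENNReal.toReal_mono (iInf_affine_ne_top E D hD hNtop hE y) (iInf_affine_mono E D hxy)
  have hlip : ∀ t, 0 ≤ t → Rr t ≤ Rr 0 + t * N := by
    intro t ht
    have h := iInf_affine_le_add E D hD le_rfl ht
    rw [sub_zero, ← hRdef, ← hRdef] at h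
    have h' := ENNReal.toReal_mono
      (ENNReal.add_ne_top.2 ⟨hfin 0, ENNReal.mul_ne_top ENNReal.ofReal_ne_top hNtop⟩) h
    rw [ENNReal.toReal_add (hfin 0) (ENNReal.mul_ne_top ENNReal.ofReal_ne_top hNtop),
      ENNReal.toReal_ofReal_mul _ _ ht, ENNReal.toReal_natCast, hRr, hRr] at h'
    exact h'
  -- reduction to the real chord inequality
  rw [← hR0]
  refine ennreal_chord_of_real_chord hs hs₀ (hfin 0) (hfin s) (hfin _) ?_
  simp only [hRr]
  -- constants: `A = KN/(2√(ρa))`, budget `(5/2)A√s₀ = (5/4)K√θ·N`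
  have hsqρa : 0 < Real.sqrt (ρ * a) := Real.sqrt_pos.2 hρa
  obtain ⟨A, hA⟩ : ∃ A : ℝ, A = K * N / (2 * Real.sqrt (ρ * a)) := ⟨_, rfl⟩
  have hA0 : 0 ≤ A := by rw [hA]; positivity
  have hbudget : 5 / 2 * A * Real.sqrt (θ * ρ * a) = 5 / 4 * (K * Real.sqrt θ) * N := by
    rw [mul_assoc θ, Real.sqrt_mul hθ.le, hA]
    field_simp
    ring
  have hKN : K * Real.sqrt θ * N ≤ m * N := mul_le_mul_of_nonneg_right hKθ hNr.le
  have hbudη : 5 / 2 * A * Real.sqrt (θ * ρ * a) ≤ η * N / 4 := by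
    rw [hbudget]
    nlinarith [mul_le_mul_of_nonneg_right hmη hNr.le]
  have hbudτ : 5 / 2 * A * Real.sqrt (θ * ρ * a) ≤ τ * N := by
    rw [hbudget]
    nlinarith [mul_le_mul_of_nonneg_right hmτ hNr.le, mul_pos hτ hNr]
  -- the rung in real form
  have hrung' : slope Rr 0 (θ * ρ * a) ≤ η * N / 4 := by
    have h := slope_le_of_ennreal_rung (Rₑ := Rₑ) (τ := η / 4) (N := (N : ℝ)) hs₀ (by positivity)
      (hfin 0) (by rw [hR0]; exact hrung hs₀)
    simp only [hRr] at h
    linarith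
  -- the walk
  have hwalk := secant_walk_real hconc hmonoR hs₀ (S := σ * ρ * a)
    (by nlinarith [mul_le_mul_of_nonneg_right hθσ hρa.le]) hA0 (M := η * N) (by positivity) hNr.le hlip
    (fun w => ∃ δ : ℝ≥0∞, 0 < δ ∧ ∀ i, E i + ENNReal.ofReal w * D i ≤ Rₑ w + δ → P i) ?_ ?_ hrung' hbudη
    s hs hsle
  · linarith
  · -- Griffiths: a secant slope below `ηN` ending at `w` makes the near-minimisers at `w` condensed
    rintro w hw ⟨w', hw'0, hw'w, hsl⟩
    obtain ⟨δ', hδ'⟩ : ∃ δ' : ℝ, δ' = (η * N - slope Rr w' w) * (w - w') / 2 := ⟨_, rfl⟩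
    have hδ'0 : 0 < δ' := by
      rw [hδ']
      exact div_pos (mul_pos (by linarith) (by linarith)) two_pos
    refine ⟨ENNReal.ofReal δ', ENNReal.ofReal_pos.2 hδ'0, fun i hi => hP i ?_⟩
    have hDi : D i ≠ ⊤ := ne_top_of_le_ne_top hNtop (hD i)
    have hsum : E i + ENNReal.ofReal w * D i ≠ ⊤ :=
      ne_top_of_le_ne_top (ENNReal.add_ne_top.2 ⟨hfin w, ENNReal.ofReal_ne_top⟩) hi
    have hEi : E i ≠ ⊤ := (ENNReal.add_ne_top.1 hsum).1
    have hmin : Rr w' ≤ (E i).toReal + w' * (D i).toReal := by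
      rw [← hRr, hRdef]
      exact toReal_iInf_affine_le E D hD hNtop hEi hw'0
    have hnear : (E i).toReal + w * (D i).toReal ≤ Rr w + δ' := by
      have h := ENNReal.toReal_mono (ENNReal.add_ne_top.2 ⟨hfin w, ENNReal.ofReal_ne_top⟩) hi
      rwa [ENNReal.toReal_add hEi (ENNReal.mul_ne_top ENNReal.ofReal_ne_top hDi),
        ENNReal.toReal_mul, ENNReal.toReal_ofReal hw.le,
        ENNReal.toReal_add (hfin w) ENNReal.ofReal_ne_top, ENNReal.toReal_ofReal hδ'0.le,
        hRr] at h
    have hd := le_slope_add_of_near_min (R := Rr) (u := w) (h := w - w') (sub_pos.2 hw'w)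
      (by rw [sub_sub_cancel]; exact hmin) hnear
    rw [sub_sub_cancel] at hd
    have hlt : (D i).toReal < η * N := by
      have hww : w - w' ≠ 0 := (sub_pos.2 hw'w).ne'
      have hq : δ' / (w - w') = (η * N - slope Rr w' w) / 2 := by
        rw [hδ']
        field_simp
      rw [hq] at hd
      linarith
    exact (ENNReal.lt_ofReal_iff_toReal_lt hDi).2 hlt
  · -- one shell in secant form
    intro u hu h4u hcw
    have h := hshell u hu h4u hcw
    have hX0 : 0 ≤ K * N * u * Real.sqrt (u / (ρ * a)) := by positivity
    have hr := toReal_three_mul_le (hfin _) (hfin _) hX0 h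
    simp only [hRr] at hr
    have hsq : Real.sqrt (u / (ρ * a)) = Real.sqrt u / Real.sqrt (ρ * a) := Real.sqrt_div' u hρa.le
    have hAu : A * Real.sqrt u * (2 * u) = K * N * u * Real.sqrt (u / (ρ * a)) := by
      rw [hsq, hA]
      field_simp
    rw [slope_def_field, slope_def_field, show 2 * u - u = u by ring, show 4 * u - 2 * u = 2 * u by ring,
      div_add' _ _ _ (by positivity : (2 : ℝ) * u ≠ 0), div_le_div_iff₀ hu (by positivity), hAu]
    have hru := mul_le_mul_of_nonneg_left hr hu.le
    linarith


end Summit.AtomisticToContinuum.BoseEinsteinCondensation.Cruxes.RewardChordBound.DyadicSecant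

end
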